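import Summits.AtomisticToContinuum.BoseEinsteinCondensation.Theses.BECModePrice
import Summits.AtomisticToContinuum.BoseEinsteinCondensation.Theorems.LatticeToPeriodicBridge.Negative.UniformThreshold
import Literature.MathematicalPhysics.QuantumManyBody.PeriodicBoseGasFracEnergy
import Literature.MathematicalPhysics.QuantumManyBody.PeriodicKineticBudget
import HarnessLib

/-!
# Negative lemmas for crux `ModePriceHardCore` (stmt-AtomisticToContinuum-18513) — II: which hypotheses
# are load-bearing, and why no explicit counterexample can be certified

Supports (does not close) stmt-AtomisticToContinuum-18513, route `BECModePrice` (rank 3). Landed copy of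
§A of the cdisprove seat's standing file `Cruxes/ModePriceHardCore/Disproof.lean` (cycle 1); `sorry`-free,
no new definition, no Theses statement asserted (the crux appears once, as a HYPOTHESIS, in
`withoutPNeZero_of_modePriceHardCore`). The SMS body at one instance `(w, N, L, s, p, Ψ)` is written
out: `E₀^per(w; N, L) + ½|2πp/L|² n_p(Ψ) ≤ ⟨Ψ, H_w Ψ⟩ + s` (`fracDispersion 2`, `planeWaveMode` of
`PeriodicBoseGasFracEnergy`, definitionally the crux's inlined terms).

* `body_zero_mode`, `withoutPNeZero_of_modePriceHardCore` — the hypothesis `p ≠ 0` is decoration: at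
  `p = 0` the subtracted dispersion vanishes; the crux implies its own `p`-unrestricted form.
* `body_of_energy_eq_top`, `body_of_groundStateEnergy_eq_top` — `⊤`-absorption (states meeting a core;
  boxes with no finite-energy state).
* `half_dispersion_mul_occupation_le`, `body_of_two_mul_le`, `energy_lt_two_mul_of_not_body` —
  PARSEVAL HALF: `½|k|²n_p(Ψ) ≤ ½E(Ψ)`; every state with `E(Ψ) ≥ 2E₀^per` satisfies the body with zero
  slack; a violator (any slack, any mode) has `E(Ψ) < 2E₀^per`. Consequence: certifying ANY
  counterexample to an SMS-shaped statement requires a lower bound on `E₀^per` within a factor `2` of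
  the energy of an explicit state, and beating the slack `Cρ = O(E₀/N)` requires two-sided control of
  `E₀^per(N, L_N)` to relative precision `O(1/N)` — beyond every printed bound (LY: `Y^{1/17}`; LHY:
  `(ρa³)^{1/2}`). This is why the crux resists refutation.
* `body_zero_particles`, `body_one_particle` — `N = 0, 1`: the body holds with zero slack for every
  potential, box and mode; "eventually in `N`" is not probed by the solvable particle numbers.
* `periodicEnergy_top_potential`, `top_potential_not_finiteRange`, `conclusion_holds_at_top_potential` —
  deleting FINITE RANGE is not refutable by the infinite-range hard core `v ≡ ⊤` (junk-true: all
  energies `⊤` for `N ≥ 2`).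
* `conclusion_body_hardCore_highDensity` — deleting the DENSITY CAP is not refutable at high density:
  above `8/a³` the hard-sphere torus energy is `⊤` eventually (tree:
  `eventually_periodicGroundStateEnergy_hardCorePotential_eq_top`), the body is junk-true; the dense
  window is as open as the crux.

References: LSSY2005 §1.2 (1.16)–(1.18) (occupations, `tr(−Δγ) = T`). `[folklore]` throughout.
-/

noncomputable section

namespace Summit.AtomisticToContinuum.BoseEinsteinCondensation.Theorems.ModePriceHardCore.Negative

open MeasureTheory Filter Metric
open scoped ENNReal NNReal Topology
open Literature.MathematicalPhysics.QuantumManyBody.BoseGas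
open Summit.AtomisticToContinuum.BoseEinsteinCondensation.Theses.BECModePrice

/-! ## `p ≠ 0` is decoration -/

/-- **Zero mode**: at `p = 0` the subtracted dispersion vanishes and the SMS body is `E₀ ≤ E(Ψ) + s`,
true for every potential, box, slack and state. [folklore] -/
theorem body_zero_mode (w : ℝ → ℝ≥0∞) (N : ℕ) (L : ℝ) (s : ℝ≥0∞) (Ψ : PeriodicTrialState N L) :
    periodicGroundStateEnergy w N L + 2⁻¹ * fracDispersion 2 L 0 * cellOccupation N L (planeWaveMode L 0) Ψ.ψ
      ≤ periodicEnergy w Ψ + s := by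
  rw [fracDispersion_zero two_ne_zero, mul_zero, zero_mul, add_zero]
  exact (periodicGroundStateEnergy_le w Ψ).trans le_self_add

/-- **The crux implies its own `p`-unrestricted form** (so `p ≠ 0` is not load-bearing: no proof
needs it, no refutation can come from `p = 0`). [folklore] -/
theorem withoutPNeZero_of_modePriceHardCore (h : ModePriceHardCore) :
    ∀ v : ℝ → ℝ≥0∞, IsRepulsiveFiniteRange v → (∫⁻ x : Space, v ‖x‖) = ⊤ →
      ∃ C : ℝ, 0 < C ∧ ∃ ρ₀ : ℝ, 0 < ρ₀ ∧ ∀ ρ : ℝ, 0 < ρ → ρ < ρ₀ →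
        ∀ᶠ N : ℕ in atTop, ∀ p : Fin 3 → ℤ,
          ∀ Ψ : PeriodicTrialState N (sideLength ρ N),
            periodicGroundStateEnergy v N (sideLength ρ N)
                + 2⁻¹ * fracDispersion 2 (sideLength ρ N) p
                  * cellOccupation N (sideLength ρ N) (planeWaveMode (sideLength ρ N) p) Ψ.ψ
              ≤ periodicEnergy v Ψ + ENNReal.ofReal (C * ρ) := by
  intro v hv hint
  obtain ⟨C, hC, ρ₀, hρ₀, h⟩ := h v hv hint
  refine ⟨C, hC, ρ₀, hρ₀, fun ρ hρ hρ₀' => (h ρ hρ hρ₀').mono fun N hN p Ψ => ?_⟩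
  by_cases hp : p = 0
  · subst hp; exact body_zero_mode v N _ _ Ψ
  · exact hN p hp Ψ

/-! ## `⊤`-absorption -/

/-- **States of infinite energy** (e.g. meeting a hard core) satisfy the body for free. [folklore] -/
theorem body_of_energy_eq_top {w : ℝ → ℝ≥0∞} {N : ℕ} {L : ℝ} (s : ℝ≥0∞) (p : Fin 3 → ℤ)
    (Ψ : PeriodicTrialState N L) (h : periodicEnergy w Ψ = ⊤) :
    periodicGroundStateEnergy w N L + 2⁻¹ * fracDispersion 2 L p * cellOccupation N L (planeWaveMode L p) Ψ.ψ
      ≤ periodicEnergy w Ψ + s := by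
  rw [h, top_add]
  exact le_top

/-- **Boxes without finite-energy states** (`E₀^per = ⊤`, e.g. too many hard spheres) satisfy the body
for every state. [folklore] -/
theorem body_of_groundStateEnergy_eq_top {w : ℝ → ℝ≥0∞} {N : ℕ} {L : ℝ} (s : ℝ≥0∞) (p : Fin 3 → ℤ)
    (Ψ : PeriodicTrialState N L) (h : periodicGroundStateEnergy w N L = ⊤) :
    periodicGroundStateEnergy w N L + 2⁻¹ * fracDispersion 2 L p * cellOccupation N L (planeWaveMode L p) Ψ.ψ
      ≤ periodicEnergy w Ψ + s :=
  body_of_energy_eq_top s p Ψ (eq_top_iff.2 (h ▸ periodicGroundStateEnergy_le w Ψ))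

/-! ## The Parseval half: violators are near-minimisers -/

/-- **Parseval half**: `½|2πp/L|² n_p(Ψ) ≤ ½⟨Ψ, H_w Ψ⟩` for every periodic trial state, mode and
potential (`∑_p |k_p|² n_p(Ψ) = T(Ψ) ≤ E(Ψ)`). [cite: LSSY2005, §1.2 (1.16)–(1.18)] -/
theorem half_dispersion_mul_occupation_le (w : ℝ → ℝ≥0∞) {N : ℕ} {L : ℝ} (hL : 0 < L)
    (p : Fin 3 → ℤ) (Ψ : PeriodicTrialState N L) :
    2⁻¹ * fracDispersion 2 L p * cellOccupation N L (planeWaveMode L p) Ψ.ψ ≤ 2⁻¹ * periodicEnergy w Ψ := by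
  rw [mul_assoc]
  gcongr
  calc fracDispersion 2 L p * cellOccupation N L (planeWaveMode L p) Ψ.ψ
      ≤ ∑' q : Fin 3 → ℤ, fracDispersion 2 L q * cellOccupation N L (planeWaveMode L q) Ψ.ψ :=
        ENNReal.le_tsum p
    _ = ∫⁻ X in cellN N L, kineticDensity Ψ.ψ X := tsum_fracDispersion_two_mul_cellOccupation hL Ψ
    _ ≤ periodicEnergy w Ψ := lintegral_kineticDensity_le_periodicEnergy w Ψ

/-- **Far states are free**: a state with `E(Ψ) ≥ 2E₀^per` satisfies the body with ZERO slack (hence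
any slack), for every mode. Only near-minimisers (`E < 2E₀`) carry content. [folklore] -/
theorem body_of_two_mul_le {w : ℝ → ℝ≥0∞} {N : ℕ} {L : ℝ} (hL : 0 < L) (s : ℝ≥0∞) (p : Fin 3 → ℤ)
    (Ψ : PeriodicTrialState N L) (h : 2 * periodicGroundStateEnergy w N L ≤ periodicEnergy w Ψ) :
    periodicGroundStateEnergy w N L + 2⁻¹ * fracDispersion 2 L p * cellOccupation N L (planeWaveMode L p) Ψ.ψ
      ≤ periodicEnergy w Ψ + s := by
  have h0 : periodicGroundStateEnergy w N L ≤ 2⁻¹ * periodicEnergy w Ψ := by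
    calc periodicGroundStateEnergy w N L = 2⁻¹ * (2 * periodicGroundStateEnergy w N L) := by
          rw [← mul_assoc, ENNReal.inv_mul_cancel two_ne_zero ENNReal.ofNat_ne_top, one_mul]
      _ ≤ 2⁻¹ * periodicEnergy w Ψ := by gcongr
  calc periodicGroundStateEnergy w N L + 2⁻¹ * fracDispersion 2 L p * cellOccupation N L (planeWaveMode L p) Ψ.ψ
      ≤ 2⁻¹ * periodicEnergy w Ψ + 2⁻¹ * periodicEnergy w Ψ :=
        add_le_add h0 (half_dispersion_mul_occupation_le w hL p Ψ)
    _ = periodicEnergy w Ψ := by rw [← add_mul, ENNReal.inv_two_add_inv_two, one_mul]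
    _ ≤ periodicEnergy w Ψ + s := le_self_add

/-- **Certifying a violation needs a lower bound on `E₀^per`**: a state violating the body (any slack,
any mode) has energy `< 2E₀^per`. [folklore] -/
theorem energy_lt_two_mul_of_not_body {w : ℝ → ℝ≥0∞} {N : ℕ} {L : ℝ} (hL : 0 < L) {s : ℝ≥0∞}
    {p : Fin 3 → ℤ} {Ψ : PeriodicTrialState N L}
    (h : ¬ (periodicGroundStateEnergy w N L
        + 2⁻¹ * fracDispersion 2 L p * cellOccupation N L (planeWaveMode L p) Ψ.ψ ≤ periodicEnergy w Ψ + s)) :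
    periodicEnergy w Ψ < 2 * periodicGroundStateEnergy w N L :=
  lt_of_not_ge fun h' => h (body_of_two_mul_le hL s p Ψ h')

/-! ## Small particle numbers are exactly solvable and TRUE -/

/-- **`N = 0`**: the occupation vanishes and the body is `E₀ ≤ E + s`. [folklore] -/
theorem body_zero_particles (w : ℝ → ℝ≥0∞) (L : ℝ) (s : ℝ≥0∞) (p : Fin 3 → ℤ)
    (Ψ : PeriodicTrialState 0 L) :
    periodicGroundStateEnergy w 0 L + 2⁻¹ * fracDispersion 2 L p * cellOccupation 0 L (planeWaveMode L p) Ψ.ψ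
      ≤ periodicEnergy w Ψ + s := by
  have h0 : cellOccupation 0 L (planeWaveMode L p) Ψ.ψ = 0 := rfl
  rw [h0, mul_zero, add_zero]
  exact (periodicGroundStateEnergy_le w Ψ).trans le_self_add

/-- **`N = 1`**: `E₀^per(1) = 0`, so the body is the Parseval half, true with ZERO slack for every
potential, every `L > 0` and every mode. [folklore] -/
theorem body_one_particle (w : ℝ → ℝ≥0∞) {L : ℝ} (hL : 0 < L) (s : ℝ≥0∞) (p : Fin 3 → ℤ)
    (Ψ : PeriodicTrialState 1 L) :
    periodicGroundStateEnergy w 1 L + 2⁻¹ * fracDispersion 2 L p * cellOccupation 1 L (planeWaveMode L p) Ψ.ψ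
      ≤ periodicEnergy w Ψ + s :=
  body_of_two_mul_le hL s p Ψ (by rw [periodicGroundStateEnergy_one hL w, mul_zero]; exact bot_le)

/-! ## Deleting finite range: the infinite-range hard core is junk-true -/

/-- For `v ≡ ⊤` and `N ≥ 2` every periodic trial state has infinite energy (the pair `(0,1)` alone
contributes `⊤·|Ψ|²`, and `∫|Ψ|² = 1`). [folklore] -/
theorem periodicEnergy_top_potential {N : ℕ} (hN : 2 ≤ N) {L : ℝ} (Ψ : PeriodicTrialState N L) :
    periodicEnergy (fun _ => (⊤ : ℝ≥0∞)) Ψ = ⊤ := by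
  have hint : ∀ X : Config N, periodicInteraction (fun _ => (⊤ : ℝ≥0∞)) L X = ⊤ := by
    intro X
    have hper : ∀ x : Space, periodizedPotential (fun _ => (⊤ : ℝ≥0∞)) L x = ⊤ := fun x =>
      ENNReal.tsum_eq_top_of_eq_top ⟨0, rfl⟩
    unfold periodicInteraction
    simp only [hper]
    rw [ENNReal.sum_eq_top]
    refine ⟨⟨0, by omega⟩, Finset.mem_univ _, ?_⟩
    rw [ENNReal.sum_eq_top]
    exact ⟨⟨1, by omega⟩, by simp [Fin.lt_def], rfl⟩
  have hpt : ∀ X ∈ cellN N L, ⊤ * ((‖Ψ.ψ X‖₊ : ℝ≥0∞) ^ 2) ≤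
      kineticDensity Ψ.ψ X + periodicInteraction (fun _ => (⊤ : ℝ≥0∞)) L X * (‖Ψ.ψ X‖₊ : ℝ≥0∞) ^ 2 := by
    intro X _
    rw [hint X]
    exact le_add_self
  have h1 : ∫⁻ X in cellN N L, ⊤ * ((‖Ψ.ψ X‖₊ : ℝ≥0∞) ^ 2) = ⊤ := by
    rw [lintegral_const_mul _ (measurable_ennnormSq Ψ.contDiff.continuous), Ψ.norm_eq, mul_one]
  rw [periodicEnergy, eq_top_iff]
  calc (⊤ : ℝ≥0∞) = ∫⁻ X in cellN N L, ⊤ * ((‖Ψ.ψ X‖₊ : ℝ≥0∞) ^ 2) := h1.symm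
    _ ≤ _ := setLIntegral_mono' (measurableSet_cellN N L) hpt

/-- `v ≡ ⊤` is measurable and non-integrable but NOT of finite range. [folklore] -/
theorem top_potential_not_finiteRange :
    Measurable (fun _ : ℝ => (⊤ : ℝ≥0∞)) ∧ (∫⁻ x : Space, (fun _ : ℝ => (⊤ : ℝ≥0∞)) ‖x‖) = ⊤ ∧
      ¬ IsRepulsiveFiniteRange (fun _ : ℝ => (⊤ : ℝ≥0∞)) := by
  refine ⟨measurable_const, by simp, fun ⟨_, R₀, hR₀⟩ => ?_⟩
  exact absurd (hR₀ (R₀ + 1) (lt_add_one R₀)) ENNReal.top_ne_zero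

/-- **The conclusion of the crux HOLDS for `v ≡ ⊤`** (junk-true: all energies `⊤` once `N ≥ 2`), so the
finite-range hypothesis cannot be shown load-bearing by the infinite-range hard core. [folklore] -/
theorem conclusion_holds_at_top_potential :
    ∃ C : ℝ, 0 < C ∧ ∃ ρ₀ : ℝ, 0 < ρ₀ ∧ ∀ ρ : ℝ, 0 < ρ → ρ < ρ₀ →
      ∀ᶠ N : ℕ in atTop, ∀ p : Fin 3 → ℤ, p ≠ 0 →
        ∀ Ψ : PeriodicTrialState N (sideLength ρ N),
          periodicGroundStateEnergy (fun _ => (⊤ : ℝ≥0∞)) N (sideLength ρ N)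
              + 2⁻¹ * fracDispersion 2 (sideLength ρ N) p
                * cellOccupation N (sideLength ρ N) (planeWaveMode (sideLength ρ N) p) Ψ.ψ
            ≤ periodicEnergy (fun _ => (⊤ : ℝ≥0∞)) Ψ + ENNReal.ofReal (C * ρ) := by
  refine ⟨1, one_pos, 1, one_pos, fun ρ _ _ => ?_⟩
  filter_upwards [eventually_ge_atTop 2] with N hN p _ Ψ
  exact body_of_energy_eq_top _ p Ψ (periodicEnergy_top_potential hN Ψ)

/-! ## Deleting the density cap: high density is junk-true -/

/-- **Above `8/a³` the body holds for the hard core of radius `a`, eventually in `N`, for every mode,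
slack and state** (the torus energy is `⊤`). The density cap `ρ < ρ₀` can only be load-bearing in the
dense-fluid / crystal window, which is as open as the crux. [folklore] -/
theorem conclusion_body_hardCore_highDensity {a : ℝ} (ha : 0 < a) {ρ : ℝ} (hρ : 8 / a ^ 3 < ρ)
    (s : ℕ → ℝ≥0∞) :
    ∀ᶠ N : ℕ in atTop, ∀ p : Fin 3 → ℤ, ∀ Ψ : PeriodicTrialState N (sideLength ρ N),
      periodicGroundStateEnergy (hardCorePotential a) N (sideLength ρ N)
          + 2⁻¹ * fracDispersion 2 (sideLength ρ N) p
            * cellOccupation N (sideLength ρ N) (planeWaveMode (sideLength ρ N) p) Ψ.ψ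
        ≤ periodicEnergy (hardCorePotential a) Ψ + s N := by
  filter_upwards [LatticeToPeriodicBridge.Negative.eventually_periodicGroundStateEnergy_hardCorePotential_eq_top
    ha hρ] with N hN p Ψ
  exact body_of_groundStateEnergy_eq_top _ p Ψ hN

end Summit.AtomisticToContinuum.BoseEinsteinCondensation.Theorems.ModePriceHardCore.Negative

end
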